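import Summits.QuantumFields.YangMills.Theorems.UnitScaleTiltProp7SymFrameCovDefs
import Literature.MathematicalPhysics.QuantumFieldTheory.Balaban1983to89.B12ContourAverage253
import HarnessLib

/-!
# `UnitScaleTiltProp7SymFrameCovariance` — W0 OF THE (47)-twˢ PLAN (OWNER RULINGS g26-№12∕№13): **THE SYMMETRIC COVARIANT FRAMES AND THE COVARIANT DOUBLE-BAR TOWER ARE GAUGE
# COVARIANT — CONJUGATION AT THE CENTRE** ([Balaban1985Averaging] (11)–(12), (58), (82), (89), (97)): for every fine gauge map `u` (and every coherent family `us i`, `us (i+1) y = us i (emb y)`),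
# the twisted centre-stair transporters, the one-level covariant frame `vframeCovU`, the double-bar field `dbarCovU`, the tower `dbarCovIterU` and the accumulated frames `frameAccU` of
# ★w5-20520 g3's ✓p614452 `Prop7SymAvgTwSym` transform by conjugation at the block centre ∕ as gauge fields; hence every NORM ROW of the frames and of the relative top-level double bar
# `U̿^{(k)}(e)·Ū₀^{(k)}(e)⁻¹` is GAUGE INVARIANT for `U1`-valued gauge maps and may be computed in ★w4 g2's cluster axial gauge — the k-uniformity device of W2∕W3∕W4
# (route `UnitScaleTilt`, crux K1 «MinimiserStabilityRegPr» stmt-QuantumFields-19200, stub `stub_existenceMinimalOrbit` (EX), route (α), node (AVG-SYM); def-free, count-neutral)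

Cell `ym3-torus` (HUMAN RULING D-0037, YM ladder rung R3 — YM₃ on T³ is a rung, not d = 4, not a mass gap, not Clay), width seat `ym-ust-20520-w4` (gen 3), W0 of the (47)-twˢ brick list of record
(RULING g26-№13 (iii)).

THE PRINT.  [Balaban1985Averaging] p. 19 (11)–(12): the averages are covariant, `\overline{U^u} = Ū^{ū}`; (58) p. 27: the twisted transporter `(R_{0,y}W₁)(Γ_{y,x})`; (82) p. 30: the block frame
`\overline{R_{0,y}W₁} = exp[Σ_x L^{−d} log (R_{0,y}W₁)(Γ_{y,x})]`; (89) p. 31, (97) p. 32 (accumulated frames `v_{j+1} = v_j·w_j`); p. 44: «all operations … are done always in a case where proper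
expressions are small» — in a convenient gauge.

WHAT IS PROVED (sorry-free, no definition; generic `P : Params`, complete normed ℂ-algebra `𝔸`):
* §1 `tstairU_gaugeActT` (`(R_{0,y}W₁^u)(Γ) = u(emb y)·(R_{0,y}W₁)(Γ)·u(emb y)⁻¹`), ★`vframeCovU_gaugeActT` (the frame conjugates at the centre, `ExpMeanLog.eml_conj`), ★`dbarCovU_gaugeActT`
  (`U̿(U₀^u, W^u) = U̿(U₀, W)^{u∘emb}`, via ✓`Prop8Chart.emlAvgU_gaugeActT`).
* §2 ★★`dbarCovIterU_frameAccU_gaugeActT` (tower covariant + accumulated frames conjugate, induction on the level), `dbarCovIterU_gaugeActT`, `frameAccU_gaugeActT`,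
  ★`dbarCovIterU_mul_inv_eq_conj` (the relative top-level double bar is a conjugate of its gauged version by `(us k e₋)⁻¹`).
* §3 (`NormOneClass 𝔸`, `U1`-valued gauge maps; lit `B12ContourAverage253.norm_units_conj_sub_one_eq`) ★`norm_frameAccU_gaugeActT_sub_one`, `norm_frameAccU_inv_gaugeActT_sub_one`, ★`norm_dbarCovIterU_mul_inv_gaugeActT_sub_one`
  — the distances to `1` are gauge INVARIANT.
HONEST FRAMING.  Pure group algebra over ✓p614452's definitions and ✓`Prop8ChartCovariance`; flat twin at `U₀ = 1`: ✓p614194 `Prop8ChartDoubleBar.dbarAvgU_gaugeActT`∕`dbarIterU_gaugeActT_eq` ((J1)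
via `dbarCovU_one`∕`dbarCovIterU_one`); nothing of print is asserted; no estimate here.  `--supports stmt-QuantumFields-19200 --as helper`.

References: T. Bałaban, CMP 98 (1985) 17–51 [Balaban1985Averaging] ((8) p.18, (11)–(12) p.19, (58) p.27, (78)/(82) p.30, (89)–(92) p.31, (97) p.32, (127) p.37, p.44); CMP 109 (1987) 249–301
[Balaban1987RG1] ((0.6) p.253).
-/

set_option autoImplicit false

noncomputable section

namespace Summit.QuantumFields.YangMills.Theorems.Prop7SymFrameCovariance

open Literature.MathematicalPhysics.QuantumFieldTheory.Balaban1983to89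
open T4Continuum BlockAveraging ExpMeanLog
open B10Eq27TorusAxialLog (holT gaugeActT gaugeActT_apply)
open B7Prop1Explicit (U1)
open B12ContourAverage253 (norm_units_conj_sub_one_eq)
open Summit.QuantumFields.YangMills.Theorems.Prop8Chart (emlAvgU emlIterU emlIterU_zero emlIterU_succ emlAvgU_gaugeActT emlIterU_gaugeActT holT_gaugeActT)
open Summit.QuantumFields.YangMills.Theorems.Prop7SymAvgTwSym (tstairU vframeCovU coe_vframeCovU dbarCovU dbarCovIterU frameAccU
  dbarCovIterU_zero dbarCovIterU_succ frameAccU_zero frameAccU_succ)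

variable {P : Params} {𝔸 : Type*} [NormedRing 𝔸] [NormedAlgebra ℂ 𝔸] [CompleteSpace 𝔸]

/-! ## §1 One level: the twisted transporters, the covariant frame and the double-bar field under a fine gauge map -/

section Level

variable {j : ℕ}

omit [NormedAlgebra ℂ 𝔸] [CompleteSpace 𝔸] in
/-- **THE TWISTED TRANSPORTER (58) CONJUGATES AT THE CENTRE**: `(R_{0,y}W₁^u)(Γ) = u(emb y)·(R_{0,y}W₁)(Γ)·u(emb y)⁻¹` — both transports along the centre stair
start at `emb y` and end at the same site, so the end factors `u(end)⁻¹·u(end)` cancel (`holT_gaugeActT`). [cite: Balaban1985Averaging, (58) p.27, (11)–(12) p.19] -/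
theorem tstairU_gaugeActT (u : GaugeTransf P j 𝔸ˣ) (U₀ W : GaugeField P j 𝔸ˣ) (y : Site P (j + 1)) (i : Idx P) :
    tstairU (gaugeActT u U₀) (gaugeActT u W) y i = u (emb y) * tstairU U₀ W y i * (u (emb y))⁻¹ := by
  unfold tstairU
  rw [holT_gaugeActT u W, holT_gaugeActT u U₀]
  group

/-- **THE COVARIANT BLOCK FRAME (82)-sym CONJUGATES AT THE CENTRE**: `w(U₀^u, W^u)(y) = u(emb y)·w(U₀, W)(y)·u(emb y)⁻¹` (`exp[mean log]` commutes with conjugation,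
`ExpMeanLog.eml_conj`). [cite: Balaban1985Averaging, (82) p.30, (78) p.30; Balaban1987RG1, (0.6) p.253] -/
theorem vframeCovU_gaugeActT (u : GaugeTransf P j 𝔸ˣ) (U₀ W : GaugeField P j 𝔸ˣ) (y : Site P (j + 1)) :
    vframeCovU (gaugeActT u U₀) (gaugeActT u W) y = u (emb y) * vframeCovU U₀ W y * (u (emb y))⁻¹ := by
  apply Units.ext
  rw [coe_vframeCovU, Units.val_mul, Units.val_mul, coe_vframeCovU]
  have h : (fun i : Idx P => ((tstairU (gaugeActT u U₀) (gaugeActT u W) y i : 𝔸ˣ) : 𝔸))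
      = fun i => ((u (emb y) : 𝔸ˣ) : 𝔸) * ((tstairU U₀ W y i : 𝔸ˣ) : 𝔸) * (((u (emb y))⁻¹ : 𝔸ˣ) : 𝔸) := by
    funext i
    rw [tstairU_gaugeActT, Units.val_mul, Units.val_mul]
  rw [h, eml_conj (Units.mul_inv _) (Units.inv_mul _)]

/-- **THE DOUBLE-BAR FIELD (89) IS GAUGE COVARIANT AT THE CENTRES**: `U̿(U₀^u, W^u) = (U̿(U₀, W))^{u∘emb}` — the single-bar average picks up `u∘emb` (`emlAvgU_gaugeActT`) and the
frames conjugate (above), so `w(c₋)⁻¹·Ū·w(c₊)` transforms as a level-`(j+1)` field. [cite: Balaban1985Averaging, (89) p.31, (11)–(12) p.19] -/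
theorem dbarCovU_gaugeActT (u : GaugeTransf P j 𝔸ˣ) (U₀ W : GaugeField P j 𝔸ˣ) :
    dbarCovU (gaugeActT u U₀) (gaugeActT u W) = gaugeActT (fun y : Site P (j + 1) => u (emb y)) (dbarCovU U₀ W) := by
  funext c
  unfold dbarCovU
  rw [gaugeActT_apply, gaugeActT_apply, gaugeActT_apply, emlAvgU_gaugeActT, gaugeActT_apply, vframeCovU_gaugeActT, vframeCovU_gaugeActT]
  group

end Level

/-! ## §2 The tower: the iterated double-bar fields and the accumulated frames (97) under a fine gauge map -/

/-- **THE TOWER IS COVARIANT, THE ACCUMULATED FRAMES CONJUGATE**: for a coherent family of gauge maps `us i` (`us (i+1) y = us i (emb y)` — e.g. `transfUp û`):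
`U̿^{(k)}(U₀^u, W^u) = (U̿^{(k)}(U₀, W))^{us k}` and `w^{(k)}(U₀^u, W^u)(y) = us k y · w^{(k)}(U₀, W)(y) · (us k y)⁻¹` ((127)∕(150) + (97), by induction on the level).
[cite: Balaban1985Averaging, (97) p.32, (127) p.37, (11)–(12) p.19] -/
theorem dbarCovIterU_frameAccU_gaugeActT (us : (i : ℕ) → GaugeTransf P i 𝔸ˣ) (hus : ∀ (i : ℕ) (y : Site P (i + 1)), us (i + 1) y = us i (emb y))
    (U₀ W : GaugeField P 0 𝔸ˣ) :
    ∀ k : ℕ, dbarCovIterU k (gaugeActT (us 0) U₀) (gaugeActT (us 0) W) = gaugeActT (us k) (dbarCovIterU k U₀ W) ∧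
      ∀ y : Site P k, frameAccU k (gaugeActT (us 0) U₀) (gaugeActT (us 0) W) y = us k y * frameAccU k U₀ W y * (us k y)⁻¹
  | 0 => ⟨by rw [dbarCovIterU_zero, dbarCovIterU_zero], fun y => by rw [frameAccU_zero, frameAccU_zero, mul_one, mul_inv_cancel]⟩
  | k + 1 => by
    obtain ⟨hW, hw⟩ := dbarCovIterU_frameAccU_gaugeActT us hus U₀ W k
    have hU : emlIterU k (gaugeActT (us 0) U₀) = gaugeActT (us k) (emlIterU k U₀) := emlIterU_gaugeActT us hus U₀ k
    refine ⟨?_, fun y => ?_⟩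
    · rw [dbarCovIterU_succ, dbarCovIterU_succ, hU, hW, dbarCovU_gaugeActT]
      congr 1
      funext y
      exact (hus k y).symm
    · rw [frameAccU_succ, frameAccU_succ, hw, hU, hW, vframeCovU_gaugeActT, ← hus k y]
      group

/-- The field half of §2. [cite: Balaban1985Averaging, (127) p.37] -/
theorem dbarCovIterU_gaugeActT (us : (i : ℕ) → GaugeTransf P i 𝔸ˣ) (hus : ∀ (i : ℕ) (y : Site P (i + 1)), us (i + 1) y = us i (emb y))
    (U₀ W : GaugeField P 0 𝔸ˣ) (k : ℕ) :
    dbarCovIterU k (gaugeActT (us 0) U₀) (gaugeActT (us 0) W) = gaugeActT (us k) (dbarCovIterU k U₀ W) :=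
  (dbarCovIterU_frameAccU_gaugeActT us hus U₀ W k).1

/-- The frame half of §2. [cite: Balaban1985Averaging, (97) p.32] -/
theorem frameAccU_gaugeActT (us : (i : ℕ) → GaugeTransf P i 𝔸ˣ) (hus : ∀ (i : ℕ) (y : Site P (i + 1)), us (i + 1) y = us i (emb y))
    (U₀ W : GaugeField P 0 𝔸ˣ) (k : ℕ) (y : Site P k) :
    frameAccU k (gaugeActT (us 0) U₀) (gaugeActT (us 0) W) y = us k y * frameAccU k U₀ W y * (us k y)⁻¹ :=
  (dbarCovIterU_frameAccU_gaugeActT us hus U₀ W k).2 y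

/-- **THE RELATIVE TOP-LEVEL DOUBLE BAR `U̿^{(k)}(c)·Ū₀^{(k)}(c)⁻¹` IS A CONJUGATE OF ITS GAUGED VERSION** (the quantity behind `dbarTwS`, print's (92)):
`U̿^{(k)}(U₀,W)(e)·Ū₀^{(k)}(e)⁻¹ = (us k e₋)⁻¹ · [U̿^{(k)}(U₀^u,W^u)(e)·(Ū₀^u)^{(k)}(e)⁻¹] · us k e₋`. [cite: Balaban1985Averaging, (92) p.31, (11)–(12) p.19] -/
theorem dbarCovIterU_mul_inv_eq_conj (us : (i : ℕ) → GaugeTransf P i 𝔸ˣ) (hus : ∀ (i : ℕ) (y : Site P (i + 1)), us (i + 1) y = us i (emb y))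
    (U₀ W : GaugeField P 0 𝔸ˣ) (k : ℕ) (e : PBond P k) :
    ((dbarCovIterU k U₀ W e : 𝔸ˣ) : 𝔸) * (((emlIterU k U₀ e)⁻¹ : 𝔸ˣ) : 𝔸) =
      (((us k e.src)⁻¹ : 𝔸ˣ) : 𝔸) *
        (((dbarCovIterU k (gaugeActT (us 0) U₀) (gaugeActT (us 0) W) e : 𝔸ˣ) : 𝔸) * (((emlIterU k (gaugeActT (us 0) U₀) e)⁻¹ : 𝔸ˣ) : 𝔸)) *
        ((us k e.src : 𝔸ˣ) : 𝔸) := by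
  have key : dbarCovIterU k U₀ W e * (emlIterU k U₀ e)⁻¹ =
      (us k e.src)⁻¹ * (dbarCovIterU k (gaugeActT (us 0) U₀) (gaugeActT (us 0) W) e * (emlIterU k (gaugeActT (us 0) U₀) e)⁻¹) * us k e.src := by
    rw [dbarCovIterU_gaugeActT us hus, emlIterU_gaugeActT us hus U₀ k, gaugeActT_apply, gaugeActT_apply]; group
  have := congrArg (fun z : 𝔸ˣ => (z : 𝔸)) key
  simpa only [Units.val_mul] using this

/-! ## §3 Norm consequences for unitary-type gauge maps (`U1 𝔸`: `‖u‖, ‖u⁻¹‖ ≤ 1`) -/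

section Norms

variable [NormOneClass 𝔸]

/-- **THE ACCUMULATED FRAME'S DISTANCE TO `1` IS GAUGE INVARIANT** under `U1`-valued coherent gauge families (so it may be computed in any convenient gauge — the k-uniformity
device of W2: ★w4 g2's cluster axial gauge). [cite: Balaban1985Averaging, (97) p.32, p.44] -/
theorem norm_frameAccU_gaugeActT_sub_one (us : (i : ℕ) → GaugeTransf P i 𝔸ˣ) (hus : ∀ (i : ℕ) (y : Site P (i + 1)), us (i + 1) y = us i (emb y))
    (hU1 : ∀ (i : ℕ) (y : Site P i), us i y ∈ U1 𝔸) (U₀ W : GaugeField P 0 𝔸ˣ) (k : ℕ) (y : Site P k) :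
    ‖((frameAccU k (gaugeActT (us 0) U₀) (gaugeActT (us 0) W) y : 𝔸ˣ) : 𝔸) - 1‖ = ‖((frameAccU k U₀ W y : 𝔸ˣ) : 𝔸) - 1‖ := by
  rw [frameAccU_gaugeActT us hus, Units.val_mul, Units.val_mul]
  exact norm_units_conj_sub_one_eq (hU1 k y) _

/-- The same for the inverse accumulated frame. [cite: Balaban1985Averaging, (97) p.32] -/
theorem norm_frameAccU_inv_gaugeActT_sub_one (us : (i : ℕ) → GaugeTransf P i 𝔸ˣ) (hus : ∀ (i : ℕ) (y : Site P (i + 1)), us (i + 1) y = us i (emb y))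
    (hU1 : ∀ (i : ℕ) (y : Site P i), us i y ∈ U1 𝔸) (U₀ W : GaugeField P 0 𝔸ˣ) (k : ℕ) (y : Site P k) :
    ‖(((frameAccU k (gaugeActT (us 0) U₀) (gaugeActT (us 0) W) y)⁻¹ : 𝔸ˣ) : 𝔸) - 1‖ = ‖(((frameAccU k U₀ W y)⁻¹ : 𝔸ˣ) : 𝔸) - 1‖ := by
  rw [frameAccU_gaugeActT us hus, mul_inv_rev, mul_inv_rev, inv_inv, ← mul_assoc, Units.val_mul, Units.val_mul]
  exact norm_units_conj_sub_one_eq (hU1 k y) _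

/-- **THE RELATIVE TOP-LEVEL DOUBLE BAR'S DISTANCE TO `1` IS GAUGE INVARIANT** (§2's conjugation by `(us k e₋)⁻¹ ∈ U1`). [cite: Balaban1985Averaging, (92) p.31, p.44] -/
theorem norm_dbarCovIterU_mul_inv_gaugeActT_sub_one (us : (i : ℕ) → GaugeTransf P i 𝔸ˣ) (hus : ∀ (i : ℕ) (y : Site P (i + 1)), us (i + 1) y = us i (emb y))
    (hU1 : ∀ (i : ℕ) (y : Site P i), us i y ∈ U1 𝔸) (U₀ W : GaugeField P 0 𝔸ˣ) (k : ℕ) (e : PBond P k) :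
    ‖((dbarCovIterU k U₀ W e : 𝔸ˣ) : 𝔸) * (((emlIterU k U₀ e)⁻¹ : 𝔸ˣ) : 𝔸) - 1‖ =
      ‖((dbarCovIterU k (gaugeActT (us 0) U₀) (gaugeActT (us 0) W) e : 𝔸ˣ) : 𝔸) * (((emlIterU k (gaugeActT (us 0) U₀) e)⁻¹ : 𝔸ˣ) : 𝔸) - 1‖ := by
  rw [dbarCovIterU_mul_inv_eq_conj us hus U₀ W k e]
  have h := norm_units_conj_sub_one_eq ((U1 𝔸).inv_mem (hU1 k e.src))
    (((dbarCovIterU k (gaugeActT (us 0) U₀) (gaugeActT (us 0) W) e : 𝔸ˣ) : 𝔸) * (((emlIterU k (gaugeActT (us 0) U₀) e)⁻¹ : 𝔸ˣ) : 𝔸))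
  rw [inv_inv] at h
  exact h

end Norms

end Summit.QuantumFields.YangMills.Theorems.Prop7SymFrameCovariance

end
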